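import Literature.AnabelianGeometry.EtaleTheta.Discharge.Sec3TemperedFrobenioidRigidOverBaseOfDataRigid
import Literature.AlgebraicGeometry.Frobenioids.ModelFrobenioidBaseChangeEquivalence
import HarnessLib

/-!
# [EtTh] Def. 3.6 tempered Frobenioids: the Φ-half of `DivisorDataRigid` is NECESSARY for the [IUTchI] Cor. 5.3 (iv) injectivity
# conclusion `RigidOverBase` at every SLIM base — every data automorphism over `id_D` has trivial divisor part (proof-only)

S. Mochizuki, *The geometry of Frobenioids I*, Kyushu J. Math. **62** (2008): §0 p. 14 («a category is slim if the natural functor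
`C_A → C` is rigid for every object `A`»), Thm. 5.2 (i)–(ii) pp. 100–101 (the model category; isomorphisms have zero divisor `0` when `Φ`
is divisorial), Cor. 5.4 p. 104 («the horizontal arrows are equivalences of categories» — functoriality of the model category in the data)
[cite: MochizukiFrdI2008, Thm. 5.2 (ii) p.101] [cite: MochizukiFrdI2008, Cor. 5.4 p.104]; S. Mochizuki, *The étale theta function …*,
Def. 3.6 p. 77 [cite: MochizukiEtTh2009, Def 3.6 p.77].  Consumer locus: [IUTchI] Cor. 5.3 (iv) p. 144 («`Aut(ℱ̲_v̲) → Aut(𝒟_v̲)` is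
bijective»; injectivity steps S3–S5 p. 145) ([IUTchI] Cor 5.3 (iv) p.144) [claim: Mochizuki2012, status: disputed] (nothing of the series
asserted; no side taken on [IUTchIII] Cor. 3.12).

PROOF-ONLY (cell abc-iut; author abc-iut-L5-t1 gen 13, row «C53IV-DDRPHI-NECESSARY» = offer (β), abc-iut-L5-lead RULINGS #184 GO, abc-iut-L2-lead
R1530 dir word; L2 directory, L5 custody).  HONEST HEADER (R1460 style): the NECESSARY direction at SLIM bases, for OUR model category; NO claim
that any carrier of record is slim; nothing here is about [FrdI] / [EtTh] / [IUTchI] Cor. 5.3 in print.  CONTEXT.  The (iv)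
telescope of record (★ `Cor53iv.tempered_descendBijective_of_isRational_of_divisorDataRigid_of_dataAction`) derives the injectivity conclusion
`CatIsomorphism.RigidOverBase C.baseFunctorOfCategory` from the [FrdI] standing hypotheses, the Def 4.5 (ii) rationality and the DISPLAYED
[EtTh] binder `DivisorDataRigid C` («every automorphism `(a, b)` of the Def 3.6 data `(Φ, B, Div_B)` over `id_D` is trivial»), known FALSE as
typed at the design carrier `temperedFrobenioidSmall` (abc-iut-f-193 ★ `not_divisorDataRigid_temperedFrobenioidSmall`: the cusp swap, a data
automorphism with `a ≠ id`, `b = id`).  THIS FILE proves the CONVERSE direction for the divisor half: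

* §1 GENERIC FORM **`ModelFrobenioid.DataHomOver.eta_apply_eq_self_of_rigidOverBase`** (absolute-name dot-notation extension of abc-iut-L1's
  structure, CONVENTIONS §2) — for ANY model data `(Φ, B, Div_B)` over a SLIM `D`
  with `Φ` objectwise divisorial, and any morphism `h` of the data over `𝟭_D` with bijective components (abc-iut-L1's
  `ModelFrobenioid.DataHomOver (𝟭 D)`): `RigidOverBase (baseFunctor Φ B Div_B)` forces `η_A(x) = x` for every `A`, `x ∈ Φ(A)`.
* §2 **`TemperedFrobenioid.dataAut_a_eq_self_of_rigidOverBase`** — at an [EtTh] Def 3.6 tempered Frobenioid under the [FrdI] Thm 5.2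
  `Hypotheses` (displayed; only `Φ` divisorial is used) over a SLIM `D`: `RigidOverBase C.baseFunctorOfCategory` forces `τ.a A x = x` for
  EVERY data automorphism `τ` of `C`, every `A` and every `x ∈ Φ(A)`.  PROOF: `τ` is a morphism of model data over `𝟭_D`, whose
  induced functor `Ψ_τ : (A, α) ↦ (A, a^gp α), (d, f, Z, u) ↦ (d, f, a Z, b u)` is a self-equivalence of `C.category` STRICTLY over `id_D`
  (Cor. 5.4, `DataHomOver.functor_isEquivalence`); `RigidOverBase` gives `ι : Ψ_τ ≅ 𝟭`; reading `Div` on the naturality square of `ι` at the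
  arrow `(1, id_A, Z, 1) : (A, 0) → (A, [Z])` (isomorphisms have `Div = 0` and `deg_Fr = 1`) gives `a_A(Z) = g_A^* Z` for the ONE
  automorphism `g_A := Base(ι_{(A,0)})` of `A`; reading `Base` on the squares at the lifts `(1, f, 0, 1) : (A, 0) → (A′, 0)` shows
  `(g_A)_A` is a natural automorphism of the forgetful functor `D_A → D` of every slice, hence trivial by slimness; so `a = id`.
* **`TemperedFrobenioid.not_rigidOverBase_of_dataAut_a_ne`** — contrapositive: a data automorphism with non-trivial divisor part at a
  slim base REFUTES `RigidOverBase` (so at such a carrier the (iv) injectivity conclusion is false AS TYPED and no repair of the displayed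
  binders can change that; the unit half `b` is NOT forced — unit twists are isomorphic to the identity, cf. ★ `Cor53ivTelescopeBinderVacuity`).
  REMARK (docstring only, CONDITIONAL): abc-iut-f-193's cusp swap (★ `not_divisorDataRigid_temperedFrobenioidSmall`) is a data automorphism
  of `temperedFrobenioidSmall` moving a divisor; IF that carrier's base `B^temp(Compat₃′)⁰` were slim (an `IsSlim` instance NOT on disk and NOT
  claimed here), `RigidOverBase` would fail there.  Nothing in this file decides slimness of any carrier.
* `TemperedFrobenioid.dataAut_a_eq_refl_of_rigidOverBase` — the same as `τ.a A = MulEquiv.refl`, the Φ-half of `DivisorDataRigid` verbatim.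

HONEST LABELS: OUR theorems about OUR model carriers (the [EtTh] Def 3.6 category IS [FrdI]'s model category in the tree); a NEGATIVE-DIRECTION
structural fact; whether the base of a given design carrier is slim is NOT decided here; refutable-as-typed at a design carrier ≠ refuted in
print (print's cusps are LABELLED, [EtTh] Prop. 1.3); no token is moved; typed ≠ inhabited ≠ proved; nothing here asserts abc proved or refuted.
-/

noncomputable section

/-! ### §1. Generic form: a morphism of model data over `𝟭_D` with bijective components, at a slim base -/

namespace Literature.AnabelianGeometry.EtaleTheta

open CategoryTheory Opposite Literature.AlgebraicGeometry.Frobenioids Literature.IUT.HodgeTheaters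

section Generic

universe w' v' u'

variable {D : Type u'} [Category.{v'} D] {Φ B : Dᵒᵖ ⥤ CommMonCat.{w'}} {DivB : B ⟶ monoidGp Φ}

/-- **GENERIC FORM ([FrdI] Thm 5.2 model category of ANY data `(D, Φ, B, Div_B)`, `Φ` objectwise divisorial, `D` slim).**  Let `h` be a
morphism of the model data over `𝟭_D` (`η : Φ → Φ`, `β : B → B` natural, `Div_B`-compatible) with bijective components, and suppose every
self-equivalence of the model category over the identity of `D` is isomorphic to the identity
(`CatIsomorphism.RigidOverBase (baseFunctor Φ B Div_B)`).  Then `η_A(x) = x` for all `A`, `x ∈ Φ(A)`: the induced functor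
`Ψ_h = (A, α) ↦ (A, η^gp α), (d, f, Z, u) ↦ (d, f, η Z, β u)` is a self-equivalence STRICTLY over `id_D` ([FrdI] Cor 5.4:
`DataHomOver.functor_isEquivalence`, `functor_comp_baseFunctor`); an isomorphism `ι : Ψ_h ≅ 𝟭` has components with `Div = 0`, `deg_Fr = 1`
([FrdI] Thm 5.2 (ii)); `Div` of its naturality square at `(1, id_A, x, 1) : (A, 0) → (A, [x])` reads `η_A(x) = Base(ι_{(A,0)})^* x`; `Base` of
the squares at the lifts `(1, f, 0, 1) : (B, 0) → (B′, 0)` makes `(Base ι_{(B,0)})_B` a natural automorphism of the forgetful functor `D_B → D`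
of every slice, trivial since `D` is slim ([FrdI] §0).
(Declared by absolute name as a dot-notation extension of abc-iut-L1's `ModelFrobenioid.DataHomOver`, lean/CONVENTIONS.md §2; abc-iut-L1-lead R267.)
[cite: MochizukiFrdI2008, Cor. 5.4 p.104] [cite: MochizukiFrdI2008, §0 p.14] -/
theorem _root_.Literature.AlgebraicGeometry.Frobenioids.ModelFrobenioid.DataHomOver.eta_apply_eq_self_of_rigidOverBase
    (h : ModelFrobenioid.DataHomOver (𝟭 D) DivB DivB) (hΦd : Objectwise (fun M _ => IsDivisorial M) Φ) (hsl : IsSlim D)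
    (hη : ∀ X : D, Function.Bijective (h.η.app (op X)).hom) (hβ : ∀ X : D, Function.Bijective (h.β.app (op X)).hom)
    (hR : CatIsomorphism.RigidOverBase (ModelFrobenioid.baseFunctor Φ B DivB)) (A : Dᵒᵖ) (x : Φ.obj A) :
    (h.η.app A).hom x = x := by
  haveI := h.functor_isEquivalence hη hβ
  -- the induced self-equivalence `Ψ_h` lies over `id_D`; rigidity gives `ι : Ψ_h ≅ 𝟭`
  obtain ⟨ι⟩ := hR h.functor.asEquivalence ⟨eqToIso h.functor_comp_baseFunctor⟩
  -- the base components of `ι` at the objects `(B, 0)`: a natural family of automorphisms of `D`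
  let X₀ : D → ModelFrobenioid Φ B DivB := fun E => ⟨E, 1⟩
  let gi : ∀ E : D, E ≅ E := fun E => (ModelFrobenioid.baseFunctor Φ B DivB).mapIso (ι.app (X₀ E))
  have hg : ∀ ⦃E E' : D⦄ (f : E ⟶ E'), f ≫ (gi E').hom = (gi E).hom ≫ f := by
    intro E E' f
    let F : X₀ E ⟶ X₀ E' :=
      { degFr := 1, base := f, div := 1, unit := 1
        rel := by
          change (1 : Algebra.GrothendieckGroup (Φ.obj (op E))) ^ ((1 : ℕ+) : ℕ) * Algebra.GrothendieckGroup.of 1 =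
            pullGp Φ f 1 * Literature.AlgebraicGeometry.Frobenioids.divB Φ B DivB (op E) 1
          rw [one_pow, map_one, map_one, map_one] }
    have n := congrArg ModelFrobenioid.baseMap (ι.hom.naturality F)
    rw [ModelFrobenioid.baseMap_comp, ModelFrobenioid.baseMap_comp] at n
    exact n
  -- slimness: the family is trivial (a natural automorphism of the forgetful functor of the slice over `B`)
  have hg1 : ∀ E : D, (gi E).hom = 𝟙 E := by
    intro E
    let α : Over.forget E ≅ Over.forget E := NatIso.ofComponents (fun U => gi U.left) (fun {U U'} k => hg k.left)
    have hα := hsl.isRigid_forget E α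
    have h1 := congrArg (fun γ : Over.forget E ≅ Over.forget E => γ.hom.app (Over.mk (𝟙 E))) hα
    simp only [α, NatIso.ofComponents_hom_app, Iso.refl_hom, NatTrans.id_app] at h1
    exact h1
  -- `Div` on the naturality square of `ι` at `(1, id, x, 1) : (A, 0) → (A, [x])`
  let A₀ : D := unop A
  let Y : ModelFrobenioid Φ B DivB := ⟨A₀, Algebra.GrothendieckGroup.of x⟩
  let f : X₀ A₀ ⟶ Y :=
    { degFr := 1, base := 𝟙 A₀, div := x, unit := 1
      rel := by
        change (1 : Algebra.GrothendieckGroup (Φ.obj (op A₀))) ^ ((1 : ℕ+) : ℕ) * Algebra.GrothendieckGroup.of x =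
          pullGp Φ (𝟙 A₀) (Algebra.GrothendieckGroup.of x) * Literature.AlgebraicGeometry.Frobenioids.divB Φ B DivB (op A₀) 1
        rw [one_pow, one_mul, pullGp_id, map_one, mul_one] }
  have n := congrArg ModelFrobenioid.div (ι.hom.naturality f)
  rw [ModelFrobenioid.div_comp, ModelFrobenioid.div_comp, ModelFrobenioid.div_eq_one_of_isIso hΦd (ι.hom.app Y),
    ModelFrobenioid.div_eq_one_of_isIso hΦd (ι.hom.app (X₀ A₀)), ModelFrobenioid.degFr_eq_one_of_isIso (ι.hom.app Y), map_one, one_mul,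
    one_pow, mul_one, PNat.one_coe, pow_one] at n
  -- `n : Div(Ψ_h f) = Base(ι_{(A,0)})^* Div f`, i.e. `η x = g_{A₀}^* x = x`
  have n' : (h.η.app A).hom x = pull Φ (gi A₀).hom x := n
  rw [n', hg1, pull_id]

end Generic

end Literature.AnabelianGeometry.EtaleTheta

/-! ### §2. At the [EtTh] Def 3.6 tempered Frobenioid: every data automorphism over `id_D` has trivial divisor part -/

namespace Literature.AnabelianGeometry.EtaleTheta

open CategoryTheory Opposite Literature.AlgebraicGeometry.Frobenioids Literature.IUT.HodgeTheaters

namespace TemperedFrobenioid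

universe u₀ v₀ u v w

variable {D₀ : Type u₀} [Category.{v₀} D₀] {V : FrdIMonoidStub.{w}}
  {T : RealifiedDivisorMonoids (D₀ := D₀) V} {D : Type u} [Category.{v} D]
  {VD : FrdICatStub.{u, v, w} D} (C : TemperedFrobenioid T D VD)

/-- **The Φ-half of `DivisorDataRigid` is NECESSARY for `RigidOverBase` at a slim base.**  Let `C` be an [EtTh] Def 3.6 tempered Frobenioid
under the [FrdI] Thm 5.2 `Hypotheses` (displayed; only «`Φ` objectwise divisorial» is used) whose base `D` is slim ([FrdI] §0).  If every
self-equivalence of `C.category` over the identity of `D` is isomorphic to the identity (`CatIsomorphism.RigidOverBase C.baseFunctorOfCategory`,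
the [IUTchI] Cor 5.3 (iv) injectivity conclusion of the tree's telescope), then every automorphism `τ = (a, b)` of the data `(Φ, B, Div_B)` over
`id_D` (abc-iut-L2-t12's `DataAut`) has `a = id` — §1 at the morphism of data over `𝟭_D` defined by `τ`.  OURS; the NECESSARY direction only;
no claim that any carrier of record is slim. [cite: MochizukiFrdI2008, Cor. 5.4 p.104] [cite: MochizukiFrdI2008, §0 p.14]
[claim: Mochizuki2012, status: disputed] -/
theorem dataAut_a_eq_self_of_rigidOverBase
    (h : ModelFrobenioid.Hypotheses C.divisorMonoid C.ratFnFunctor) (hsl : IsSlim D)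
    (hR : CatIsomorphism.RigidOverBase C.baseFunctorOfCategory) (τ : C.DataAut)
    (A : Dᵒᵖ) (x : C.divisorMonoid.obj A) : τ.a A x = x := by
  -- `τ` as a morphism of model data over `𝟭_D`
  let hd : ModelFrobenioid.DataHomOver (𝟭 D) C.divBNatTrans C.divBNatTrans :=
    { η := { app := fun A => CommMonCat.ofHom (τ.a A).toMonoidHom
             naturality := fun A A' f => by
               apply CommMonCat.hom_ext
               ext y
               exact τ.a_natural f.unop y }
      β := { app := fun A => CommMonCat.ofHom (τ.b A).toMonoidHom
             naturality := fun A A' f => by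
               apply CommMonCat.hom_ext
               ext u
               exact τ.b_natural f.unop u }
      comm := fun A u => (τ.divB_b A u).symm }
  exact hd.eta_apply_eq_self_of_rigidOverBase h.isDivisorial hsl (fun X => (τ.a (op X)).bijective)
    (fun X => (τ.b (op X)).bijective) hR A x

/-- **Contrapositive: a data automorphism with non-trivial divisor part REFUTES the (iv) injectivity conclusion at a slim base.**  Under the
[FrdI] Thm 5.2 `Hypotheses`, if `D` is slim and some automorphism `τ` of the Def 3.6 data over `id_D` moves some zero divisor (`τ.a A x ≠ x`),
then `¬ RigidOverBase C.baseFunctorOfCategory`: the self-equivalence `Ψ_τ` over `id_D` is not isomorphic to the identity — at such a carrier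
no repair of the DISPLAYED binders of the (iv) telescope can produce the conclusion.  (REMARK, CONDITIONAL, nothing claimed: abc-iut-f-193's
cusp swap ★ `not_divisorDataRigid_temperedFrobenioidSmall` is such a `τ` at `temperedFrobenioidSmall`; whether that carrier's base is slim is
NOT on disk and NOT decided here.) [cite: MochizukiFrdI2008, Cor. 5.4 p.104] [claim: Mochizuki2012, status: disputed] -/
theorem not_rigidOverBase_of_dataAut_a_ne
    (h : ModelFrobenioid.Hypotheses C.divisorMonoid C.ratFnFunctor) (hsl : IsSlim D)
    (τ : C.DataAut) (A : Dᵒᵖ) (x : C.divisorMonoid.obj A) (hx : τ.a A x ≠ x) :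
    ¬ CatIsomorphism.RigidOverBase C.baseFunctorOfCategory :=
  fun hR => hx (C.dataAut_a_eq_self_of_rigidOverBase h hsl hR τ A x)

/-- **Reformulation next to the displayed binder**: under the [FrdI] Thm 5.2 `Hypotheses` at a slim base, `RigidOverBase` implies the Φ-HALF
of `DivisorDataRigid C` (★ p527197: `τ.a A = id` for every data automorphism `τ`) — so, modulo the [FrdI] standing hypotheses of the telescope,
that half is NECESSARY as well as (jointly with the rest, by the knit of record
★ `Cor53iv.tempered_descendBijective_of_isRational_of_divisorDataRigid_of_dataAction`) sufficient; the unit half is not addressed here.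
[cite: MochizukiFrdI2008, Cor. 5.4 p.104] [claim: Mochizuki2012, status: disputed] -/
theorem dataAut_a_eq_refl_of_rigidOverBase
    (h : ModelFrobenioid.Hypotheses C.divisorMonoid C.ratFnFunctor) (hsl : IsSlim D)
    (hR : CatIsomorphism.RigidOverBase C.baseFunctorOfCategory) (τ : C.DataAut) (A : Dᵒᵖ) :
    τ.a A = MulEquiv.refl _ :=
  MulEquiv.ext fun x => C.dataAut_a_eq_self_of_rigidOverBase h hsl hR τ A x

end TemperedFrobenioid

end Literature.AnabelianGeometry.EtaleTheta

end
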